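import Mathlib
import Literature.Analysis.ODE.InverseSquareLadder
import HarnessLib

/-!
# Expansion of the Darboux ladder: `ladder ι n u = Σ_{j ≤ n} β_j ι^{n−j} u^{(j)}` where `ι' = −ι²`

Analysis/ODE support file (everything proved). On an open set `S` where the coefficient satisfies the
Riccati relation `ι' = −ι²` (so `ι = 1/(x − x₀)`), the ladder `ladder ι n = (∂ − nι)∘⋯∘(∂ − ι)` of
`InverseSquareLadder.lean` is a differential operator of order `n` with coefficients that are pure
powers of `ι`: there are real constants `β_0, …, β_n` with `β_n = 1`, depending only on `n`, such that
`ladder ι n u (x) = Σ_{j=0}^{n} β_j ι(x)^{n−j} u^{(j)}(x)` for all `u ∈ Cⁿ` and `x ∈ S`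
(`exists_ladder_expansion`; recursion `β'_j = β_{j−1} − (2n+1−j)β_j`). This is the structural input
for the large-time asymptotics of the exact inverse-square waves `ladder ι n Φ(t,·)` on exterior cones
(`x^{j−n}`-weighted lower-order terms), route PhotonSphereChannels, `FixedModeChannels`, far side
(stmt-FinalStateConjecture-10048). Folklore (Kenig–Lawrie–Liu–Schlag 2015, §2 in radial form).
-/

noncomputable section

namespace Literature.Analysis.ODE

open Set Filter Topology Finset

variable {ι : ℝ → ℝ}

/-- **Expansion of the ladder in powers of `ι`.** See the module docstring. [folklore] -/
theorem exists_ladder_expansion (hι : ContDiff ℝ (⊤ : ℕ∞) ι) {S : Set ℝ} (hS : IsOpen S)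
    (hι' : ∀ x ∈ S, deriv ι x = -(ι x) ^ 2) (n : ℕ) :
    ∃ β : ℕ → ℝ, β n = 1 ∧ ∀ u : ℝ → ℝ, ContDiff ℝ n u → ∀ x ∈ S,
      ladder ι n u x = ∑ j ∈ range (n + 1), β j * ι x ^ (n - j) * iteratedDeriv j u x := by
  have hιd : ∀ y, HasDerivAt ι (deriv ι y) y := fun y =>
    (hι.differentiable (by simp) y).hasDerivAt
  induction n with
  | zero =>
    refine ⟨fun j => if j = 0 then 1 else 0, by simp, fun u _ x _ => ?_⟩
    simp
  | succ n ih =>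
    obtain ⟨β, hβn, hexp⟩ := ih
    -- extended old coefficients and the new ones
    set B : ℕ → ℝ := fun j => if j ≤ n then β j else 0 with hB
    set β' : ℕ → ℝ := fun j => (if j = 0 then 0 else B (j - 1)) - ((2 * n + 1 : ℝ) - j) * B j
      with hβ'
    have hBn1 : B (n + 1) = 0 := by simp [hB]
    have hBle : ∀ j ≤ n, B j = β j := fun j hj => by simp [hB, hj]
    refine ⟨β', ?_, fun u hu x hx => ?_⟩
    · simp only [hβ']
      rw [if_neg (Nat.succ_ne_zero n), Nat.add_sub_cancel, hBle n le_rfl, hβn, hBn1]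
      ring
    · -- regularity
      have hun : ContDiff ℝ n u := hu.of_le (by exact_mod_cast Nat.le_succ n)
      have hdj : ∀ j ≤ n, HasDerivAt (iteratedDeriv j u) (iteratedDeriv (j + 1) u x) x := by
        intro j hj
        have h := (hu.differentiable_iteratedDeriv j (by exact_mod_cast Nat.lt_succ_of_le hj) x)
          |>.hasDerivAt
        rwa [← iteratedDeriv_succ] at h
      -- the level-`n` ladder near `x`
      have hev : ladder ι n u =ᶠ[𝓝 x]
          fun y => ∑ j ∈ range (n + 1), β j * ι y ^ (n - j) * iteratedDeriv j u y :=
        Filter.eventuallyEq_of_mem (hS.mem_nhds hx) fun y hy => hexp u hun y hy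
      -- derivative of the expansion at `x`
      have hterm : ∀ j ∈ range (n + 1), HasDerivAt
          (fun y => β j * ι y ^ (n - j) * iteratedDeriv j u y)
          (β j * (((n - j : ℕ) : ℝ) * ι x ^ (n - j - 1) * deriv ι x) * iteratedDeriv j u x
            + β j * ι x ^ (n - j) * iteratedDeriv (j + 1) u x) x := by
        intro j hj
        have hjn : j ≤ n := Nat.lt_succ_iff.1 (mem_range.1 hj)
        exact (((hιd x).pow (n - j)).const_mul (β j)).mul (hdj j hjn)
      have hsum : HasDerivAt (fun y => ∑ j ∈ range (n + 1), β j * ι y ^ (n - j) * iteratedDeriv j u y)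
          (∑ j ∈ range (n + 1), (β j * (((n - j : ℕ) : ℝ) * ι x ^ (n - j - 1) * deriv ι x)
            * iteratedDeriv j u x + β j * ι x ^ (n - j) * iteratedDeriv (j + 1) u x)) x :=
        HasDerivAt.fun_sum hterm
      have hder : deriv (ladder ι n u) x = ∑ j ∈ range (n + 1),
          (β j * (((n - j : ℕ) : ℝ) * ι x ^ (n - j - 1) * deriv ι x) * iteratedDeriv j u x
            + β j * ι x ^ (n - j) * iteratedDeriv (j + 1) u x) := by
        rw [hev.deriv_eq]; exact hsum.deriv
      -- simplify `(n-j) ι^{n-j-1} ι' = -(n-j) ι^{n-j+1}` termwise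
      have hpow : ∀ j ∈ range (n + 1),
          ((n - j : ℕ) : ℝ) * ι x ^ (n - j - 1) * deriv ι x = -((n : ℝ) - j) * ι x ^ (n + 1 - j) := by
        intro j hj
        have hjn : j ≤ n := Nat.lt_succ_iff.1 (mem_range.1 hj)
        rcases Nat.eq_or_lt_of_le hjn with rfl | hlt
        · simp
        · have h1 : n - j = (n - j - 1) + 1 := by omega
          have h2 : n + 1 - j = (n - j - 1) + 2 := by omega
          rw [hι' x hx, Nat.cast_sub hjn, h2, pow_add]
          conv_lhs => rw [h1, Nat.add_sub_cancel]
          ring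
      -- assemble
      rw [ladder_succ, ladderStep_apply, hder, hexp u hun x hx]
      -- rewrite the target sum over `range (n+2)` as shifted old sums
      have hR : ∑ j ∈ range (n + 1 + 1), β' j * ι x ^ (n + 1 - j) * iteratedDeriv j u x
          = (∑ j ∈ range (n + 1), β j * ι x ^ (n - j) * iteratedDeriv (j + 1) u x)
            - ∑ j ∈ range (n + 1), ((2 * n + 1 : ℝ) - j) * β j * ι x ^ (n + 1 - j)
                * iteratedDeriv j u x := by
        have e1 : ∀ j ∈ range (n + 1 + 1), β' j * ι x ^ (n + 1 - j) * iteratedDeriv j u x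
            = (if j = 0 then 0 else B (j - 1)) * ι x ^ (n + 1 - j) * iteratedDeriv j u x
              - ((2 * n + 1 : ℝ) - j) * B j * ι x ^ (n + 1 - j) * iteratedDeriv j u x := by
          intro j _; simp only [hβ']; ring
        rw [sum_congr rfl e1, sum_sub_distrib]
        congr 1
        · have f0 : (if (0 : ℕ) = 0 then (0 : ℝ) else B (0 - 1)) * ι x ^ (n + 1 - 0)
              * iteratedDeriv 0 u x = 0 := by simp
          rw [sum_range_succ', f0, add_zero]
          refine sum_congr rfl fun j hj => ?_
          have hjn : j ≤ n := Nat.lt_succ_iff.1 (mem_range.1 hj)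
          have e2 : n + 1 - (j + 1) = n - j := by omega
          rw [if_neg (Nat.succ_ne_zero j), Nat.add_sub_cancel, hBle j hjn, e2]
        · rw [sum_range_succ, hBn1]
          simp only [mul_zero, zero_mul, add_zero]
          refine sum_congr rfl fun j hj => ?_
          rw [hBle j (Nat.lt_succ_iff.1 (mem_range.1 hj))]
      rw [hR, mul_sum, ← sum_sub_distrib, ← sum_sub_distrib]
      refine sum_congr rfl fun j hj => ?_
      rw [hpow j hj]
      have hjn : j ≤ n := Nat.lt_succ_iff.1 (mem_range.1 hj)
      have e : ι x ^ (n + 1 - j) = ι x * ι x ^ (n - j) := by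
        rw [show n + 1 - j = (n - j) + 1 by omega, pow_succ]; ring
      rw [e]
      push_cast
      ring

end Literature.Analysis.ODE
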